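import Mathlib
import Literature.MathematicalPhysics.KineticTheory.HardSphereEuler
import HarnessLib

/-!
# `OneFlightGossipEngine.OneFlightLayeredChaos` — stub `transverse_offset_eq_zero_iff` of line `Sketch`
(crux stmt-AtomisticToContinuum-14535)

First lemma of the idea card `collision-time-coordinates` (crux dir `Cruxes/OneFlightLayeredChaos/Ideas/`):
at a collision with contact normal `ω` and incoming relative velocity `g` with `⟪ω, g⟫ ≠ 0`, a relative
position offset `δ` of the colliding pair moves the contact normal by (a multiple of) the transverse offset
`δ - (⟪ω, δ⟫ / ⟪ω, g⟫) • g`, the oblique projection of `δ` along `g` onto the plane `ω^⊥`. This transverse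
offset vanishes exactly on the line spanned by `g`. Pure linear algebra in the real inner product space
`V3 = EuclideanSpace ℝ (Fin 3)`.
-/

namespace Summit.AtomisticToContinuum.HydrodynamicLimit.Theorems

/-- **Transverse offset vanishes iff the offset is along the relative velocity.** For
`ω g δ : V3` with `⟪ω, g⟫ ≠ 0`, `δ - (⟪ω, δ⟫ / ⟪ω, g⟫) • g = 0 ↔ ∃ c, δ = c • g`.
(`→`: take `c = ⟪ω, δ⟫ / ⟪ω, g⟫`; `←`: `⟪ω, c • g⟫ = c ⟪ω, g⟫` and cancel `⟪ω, g⟫ ≠ 0`.)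
Registered stub `transverse_offset_eq_zero_iff` of line `Sketch` (first lemma of card
`collision-time-coordinates`). [folklore] -/
theorem transverse_offset_eq_zero_iff
    (ω g δ : Literature.MathematicalPhysics.KineticTheory.V3)
    (hg : inner ℝ ω g ≠ 0) :
    δ - (inner ℝ ω δ / inner ℝ ω g) • g = 0 ↔ ∃ c : ℝ, δ = c • g := by
  constructor
  · intro h
    exact ⟨inner ℝ ω δ / inner ℝ ω g, sub_eq_zero.mp h⟩
  · rintro ⟨c, rfl⟩
    rw [real_inner_smul_right, mul_div_cancel_right₀ c hg, sub_self]

end Summit.AtomisticToContinuum.HydrodynamicLimit.Theorems
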